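import Summits.BirchSwinnertonDyer.BirchSwinnertonDyer.Theorems.ManinLocalTwoThreeCuspSymbolBoundary
import Literature.NumberTheory.EllipticCurves.Gamma0CocycleDegeneracyMaps
import Mathlib.Topology.Compactification.OnePoint.ProjectiveLine
import HarnessLib

/-!
# The symbol ⟷ cocycle DICTIONARY for E-es-35: Hecke operators and the level shift on `Γ₀(L)`-cusp symbols commute
# with the boundary map `Φ ↦ (γ ↦ Φ(∞, γ∞))` (MEMO-es §22.2 / §23.4, «p3: the dictionary»)

Summit `BirchSwinnertonDyer`, route `ManinLocalTwoThree` (cell bsd-f2-manin), deciding crux C2 `ManinOddAtFour`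
(stmt-BirchSwinnertonDyer-22967) and crux C3 `ManinPrimeToThreeAtNine` (stmt-BirchSwinnertonDyer-22968), through the
generation stubs ⟸ leaf E-es-25 `RelativeIharaShiftVanishingBar` ⟸ E-es-35 `ShiftInvariantIsDiamond`
(`Theorems/ManinLocalTwoThreeDiamondEisenstein.lean`).  The proof of E-es-35 (MEMO-es §23.2) moves between degree-`0`
cocycles `u : Γ₀(L) → K` (the tree's `HidaCohomology.cocycles 0 L K`, Hecke operator `heckeU 0 L K hℓ` of
Shimura (8.3.2) with the representatives `heckeRep ℓ` and permutation data `heckePerm`/`heckePermElt`, level maps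
`degeneracyPullback`) and `Γ₀(L)`-invariant additive cusp symbols `Φ : P¹(ℚ) × P¹(ℚ) → K` (p2's
`Theorems/ManinLocalTwoThreeCuspSymbolBoundary.lean`, Mathlib's `OnePoint ℚ` with `OnePoint.instGLAction`).  This file is
the dictionary between the two, DEFINITION-FREE (the Hecke operator on symbols is the explicit sum
`(a,b) ↦ Σ_i Φ(βᵢ a, βᵢ b)` over a BINDER-SIDE family `β : HeckeIdx L ℓ → GL₂(ℚ)` with matrices `heckeRep ℓ`; the shift is
`(a,b) ↦ Φ(A a, A b)` for a binder-side `A` with matrix `diag(d, 1)`):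

* §1 `heckeRep_intertwine` — in `GL₂(ℚ)`: `βᵢ · γ = γ'ᵢ · β_{σ(i)}` (the tree's `heckePermElt_spec`, cast);
  `hecke_cuspSymbol_symbol` / `hecke_cuspSymbol_invariant` — `T_ℓ` preserves additivity and `Γ₀(L)`-invariance;
  **`delta_hecke_cuspSymbol`** — `δ(T_ℓ Φ) = T_ℓ(δ Φ)`: `(T_ℓΦ)(∞, γ∞) = Σ_i Φ(∞, γ'ᵢ ∞) = (heckeU (δΦ))(γ)` for every
  `Γ₀(L)`-invariant symbol (the boundary terms `Σ_i [Φ(βᵢ∞, ∞) + Φ(∞, β_{σ(i)}∞)]` cancel after reindexing by the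
  bijection `σ = heckePermEquiv`); `delta_hecke_cuspSymbol_eq_heckeU` is the cochain form.
* §2 `diag_intertwine` — `A · γ = δ_d(γ) · A` for `γ ∈ Γ₀(L')`, `L d ∣ L'`, `δ_d = Gamma0.degeneracyConj` (the tree's
  `Gamma0.gmat_degeneracyConj_mul_diag`, cast); `shift_cuspSymbol_invariant` — `Φ∘A` is `Γ₀(L')`-invariant;
  **`delta_shift_cuspSymbol`** — `δ_{L'}(Φ∘A) = π_d^*(δ_L Φ)` and `delta_restrict_cuspSymbol` — `δ_{L'}Φ = π_1^*(δ_L Φ)`;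
  hence **`exists_boundary_of_shiftInvariant`** — if `π_d^* u = π_1^* u` for `u = δ_L Φ` then the DISCREPANCY
  `D = Φ∘A − Φ` is a `Γ₀(L')`-invariant symbol with `δ_{L'} D = 0`, i.e. a BOUNDARY symbol of level `L'`
  (p2's `exists_boundary_of_delta_eq_zero`) — MEMO-es §22.2 (2) verbatim.

What is NOT here (next files): `T_ℓ` commutes with the shift (reindexing `j ↦ d j` of the representatives), the
finite-dimensionality of `Hom(Γ₀(L), K)` and of boundary symbols, the generalised-eigenspace lift, E-es-30 and LEMMA G.
Nothing here is specific to elliptic curves; nothing about BSD or Manin's conjecture is proved by this file.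

References: HOME/MEMO-es.md §22.2, §23.2–23.4 (cell bsd-f2-manin); [Shimura1971] §8.3 (8.3.2); [DiamondShurman2005]
§5.2 (representatives `β_j = (1 j; 0 ℓ)`, `β_∞ = diag(ℓ,1)`); Ju. I. Manin, Izv. 36 (1972) §1; G. Stevens, *Arithmetic on
modular curves* (1982) Ch. 1.
-/

set_option autoImplicit false
set_option linter.dupNamespace false

open scoped MatrixGroups

open CongruenceSubgroup Matrix.SpecialLinearGroup Literature.NumberTheory.EllipticCurves.ModularForms
  Literature.NumberTheory.EllipticCurves.ModularForms.HidaCohomology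

namespace Summit.BirchSwinnertonDyer.BirchSwinnertonDyer.Theorems.ManinLocalTwoThree

/-! ### §0  Plumbing: integer matrices in `GL₂(ℚ)` -/

section Plumbing

/-- Entries of `mapGL ℚ γ` are the integer entries of `γ` (plumbing). [folklore] -/
theorem coe_mapGL_apply (γ : SL(2, ℤ)) (i j : Fin 2) :
    ((mapGL ℚ γ : GL (Fin 2) ℚ) : Matrix (Fin 2) (Fin 2) ℚ) i j = ((γ i j : ℤ) : ℚ) := rfl

/-- Two elements of `GL₂(ℚ)` whose matrices are the casts of integer matrices `X`, `Y` multiply to the cast of `X Y`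
(plumbing). [folklore] -/
theorem coe_mul_eq_cast_mul {g h : GL (Fin 2) ℚ} {X Y : Matrix (Fin 2) (Fin 2) ℤ}
    (hg : (g : Matrix (Fin 2) (Fin 2) ℚ) = X.map (Int.castRingHom ℚ))
    (hh : (h : Matrix (Fin 2) (Fin 2) ℚ) = Y.map (Int.castRingHom ℚ)) :
    ((g * h : GL (Fin 2) ℚ) : Matrix (Fin 2) (Fin 2) ℚ) = (X * Y).map (Int.castRingHom ℚ) := by
  rw [Units.val_mul, hg, hh, Matrix.map_mul]

/-- The matrix of `mapGL ℚ γ` is the cast of the integer matrix of `γ` (plumbing). [folklore] -/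
theorem coe_mapGL_eq_map (γ : SL(2, ℤ)) :
    ((mapGL ℚ γ : GL (Fin 2) ℚ) : Matrix (Fin 2) (Fin 2) ℚ) = (γ : Matrix (Fin 2) (Fin 2) ℤ).map (Int.castRingHom ℚ) := by
  ext i j; rfl

end Plumbing

/-! ### §1  Hecke operators on cusp symbols and `δ ∘ T_ℓ = T_ℓ ∘ δ` -/

section Hecke

variable {L : ℕ} {K : Type*} [AddCommGroup K] {ℓ : ℕ} [NeZero ℓ] (hℓ : ℓ.Prime)
  (β : HeckeIdx L ℓ → GL (Fin 2) ℚ)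
  (hβ : ∀ i, (β i : Matrix (Fin 2) (Fin 2) ℚ) = (heckeRep ℓ i.1).map (Int.castRingHom ℚ))

include hℓ hβ

omit [NeZero ℓ] in
/-- **The intertwining relation in `GL₂(ℚ)`**: `βᵢ · γ = γ'ᵢ · β_{σ(i)}` for `γ ∈ Γ₀(L)`, `γ'ᵢ = heckePermElt γ i`,
`σ = heckePerm γ` (the tree's `heckePermElt_spec`, cast from integer matrices). [folklore] -/
theorem heckeRep_intertwine (γ : Gamma0 L) (i : HeckeIdx L ℓ) :
    β i * mapGL ℚ (γ : SL(2, ℤ)) =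
      mapGL ℚ (heckePermElt hℓ γ i : SL(2, ℤ)) * β (heckePerm hℓ γ i) := by
  apply Units.ext
  rw [coe_mul_eq_cast_mul (hβ i) (coe_mapGL_eq_map _),
    coe_mul_eq_cast_mul (coe_mapGL_eq_map _) (hβ (heckePerm hℓ γ i)), heckePermElt_spec hℓ γ i]

variable (Φ : OnePoint ℚ → OnePoint ℚ → K)

omit hℓ hβ in
/-- `T_ℓ` preserves additivity of symbols. [folklore] -/
theorem hecke_cuspSymbol_symbol (hsym : ∀ a b c, Φ a b + Φ b c = Φ a c) (a b c : OnePoint ℚ) :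
    (∑ i : HeckeIdx L ℓ, Φ (β i • a) (β i • b)) + (∑ i : HeckeIdx L ℓ, Φ (β i • b) (β i • c)) =
      ∑ i : HeckeIdx L ℓ, Φ (β i • a) (β i • c) := by
  rw [← Finset.sum_add_distrib]
  exact Finset.sum_congr rfl fun i _ => hsym _ _ _

/-- **`T_ℓ` preserves `Γ₀(L)`-invariance**: `Σ_i Φ(βᵢγa, βᵢγb) = Σ_i Φ(γ'ᵢ β_{σ(i)} a, …) = Σ_i Φ(β_{σ(i)}a, β_{σ(i)}b)`,
reindexed by the bijection `σ`. [folklore] -/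
theorem hecke_cuspSymbol_invariant
    (hinv : ∀ γ : Gamma0 L, ∀ a b, Φ (mapGL ℚ (γ : SL(2, ℤ)) • a) (mapGL ℚ (γ : SL(2, ℤ)) • b) = Φ a b)
    (γ : Gamma0 L) (a b : OnePoint ℚ) :
    (∑ i : HeckeIdx L ℓ, Φ (β i • mapGL ℚ (γ : SL(2, ℤ)) • a) (β i • mapGL ℚ (γ : SL(2, ℤ)) • b)) =
      ∑ i : HeckeIdx L ℓ, Φ (β i • a) (β i • b) := by
  have hterm : ∀ i : HeckeIdx L ℓ, Φ (β i • mapGL ℚ (γ : SL(2, ℤ)) • a) (β i • mapGL ℚ (γ : SL(2, ℤ)) • b) =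
      Φ (β (heckePerm hℓ γ i) • a) (β (heckePerm hℓ γ i) • b) := by
    intro i
    rw [← mul_smul, ← mul_smul, heckeRep_intertwine hℓ β hβ γ i, mul_smul, mul_smul, hinv]
  rw [Finset.sum_congr rfl fun i _ => hterm i]
  exact Equiv.sum_comp (heckePermEquiv hℓ γ) (fun i => Φ (β i • a) (β i • b))

/-- **`δ ∘ T_ℓ = T_ℓ ∘ δ` on `Γ₀(L)`-invariant symbols, pointwise**: `(T_ℓΦ)(∞, γ∞) = Σ_i Φ(∞, γ'ᵢ∞)`.
Per term `Φ(βᵢ∞, γ'ᵢβ_{σ(i)}∞) = Φ(βᵢ∞, ∞) + Φ(∞, γ'ᵢ∞) + Φ(∞, β_{σ(i)}∞)` (additivity twice, invariance under `γ'ᵢ`),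
and `Σ_i [Φ(βᵢ∞, ∞) + Φ(∞, β_{σ(i)}∞)] = Σ_i [Φ(βᵢ∞,∞) + Φ(∞,βᵢ∞)] = 0` (reindex by `σ`, antisymmetry).
MEMO-es §22.2 («`T_r` on symbols … commutes with `δ`»). [folklore] -/
theorem delta_hecke_cuspSymbol (hsym : ∀ a b c, Φ a b + Φ b c = Φ a c)
    (hinv : ∀ γ : Gamma0 L, ∀ a b, Φ (mapGL ℚ (γ : SL(2, ℤ)) • a) (mapGL ℚ (γ : SL(2, ℤ)) • b) = Φ a b)
    (γ : Gamma0 L) :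
    (∑ i : HeckeIdx L ℓ, Φ (β i • OnePoint.infty) (β i • mapGL ℚ (γ : SL(2, ℤ)) • OnePoint.infty)) =
      ∑ i : HeckeIdx L ℓ, Φ OnePoint.infty (mapGL ℚ (heckePermElt hℓ γ i : SL(2, ℤ)) • OnePoint.infty) := by
  -- per-term decomposition
  have hterm : ∀ i : HeckeIdx L ℓ, Φ (β i • OnePoint.infty) (β i • mapGL ℚ (γ : SL(2, ℤ)) • OnePoint.infty) =
      (Φ (β i • OnePoint.infty) OnePoint.infty + Φ OnePoint.infty (β (heckePerm hℓ γ i) • OnePoint.infty)) +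
        Φ OnePoint.infty (mapGL ℚ (heckePermElt hℓ γ i : SL(2, ℤ)) • OnePoint.infty) := by
    intro i
    rw [← mul_smul, heckeRep_intertwine hℓ β hβ γ i, mul_smul,
      ← hsym (β i • OnePoint.infty) OnePoint.infty _,
      ← hsym OnePoint.infty (mapGL ℚ (heckePermElt hℓ γ i : SL(2, ℤ)) • OnePoint.infty) _]
    -- `Φ(γ'∞, γ' β' ∞) = Φ(∞, β'∞)` by invariance under `γ'`
    have e : Φ (mapGL ℚ (heckePermElt hℓ γ i : SL(2, ℤ)) • OnePoint.infty)
        (mapGL ℚ (heckePermElt hℓ γ i : SL(2, ℤ)) • β (heckePerm hℓ γ i) • OnePoint.infty) =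
        Φ OnePoint.infty (β (heckePerm hℓ γ i) • OnePoint.infty) := hinv _ _ _
    rw [e]
    abel
  rw [Finset.sum_congr rfl fun i _ => hterm i, Finset.sum_add_distrib, Finset.sum_add_distrib]
  -- the boundary terms cancel after reindexing by `σ`
  have hσ : (∑ i : HeckeIdx L ℓ, Φ OnePoint.infty (β (heckePerm hℓ γ i) • OnePoint.infty)) =
      ∑ i : HeckeIdx L ℓ, Φ OnePoint.infty (β i • OnePoint.infty) :=
    Equiv.sum_comp (heckePermEquiv hℓ γ) (fun i => Φ OnePoint.infty (β i • OnePoint.infty))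
  rw [hσ, ← Finset.sum_add_distrib]
  have h0 : ∀ i : HeckeIdx L ℓ, Φ (β i • OnePoint.infty) OnePoint.infty + Φ OnePoint.infty (β i • OnePoint.infty) = 0 :=
    fun i => by rw [hsym, cuspSymbol_self Φ hsym]
  rw [Finset.sum_congr rfl fun i _ => h0 i, Finset.sum_const_zero, zero_add]

end Hecke

section HeckeCochain

variable {L : ℕ} {K : Type*} [CommRing K] {ℓ : ℕ} [NeZero ℓ] (hℓ : ℓ.Prime)
  (β : HeckeIdx L ℓ → GL (Fin 2) ℚ)
  (hβ : ∀ i, (β i : Matrix (Fin 2) (Fin 2) ℚ) = (heckeRep ℓ i.1).map (Int.castRingHom ℚ))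
  (Φ : OnePoint ℚ → OnePoint ℚ → K)

include hβ

/-- **`δ ∘ T_ℓ = T_ℓ ∘ δ`, cochain form**: the boundary cochain of `T_ℓ Φ` is `heckeU 0 L K hℓ` of the boundary cochain of
`Φ` (Shimura (8.3.2) in degree `0`: `(T u)(γ) = Σ_i u(γ'ᵢ)`). [folklore] -/
theorem delta_hecke_cuspSymbol_eq_heckeU (hsym : ∀ a b c, Φ a b + Φ b c = Φ a c)
    (hinv : ∀ γ : Gamma0 L, ∀ a b, Φ (mapGL ℚ (γ : SL(2, ℤ)) • a) (mapGL ℚ (γ : SL(2, ℤ)) • b) = Φ a b) :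
    (fun (γ : Gamma0 L) (_ : Fin 1) =>
        ∑ i : HeckeIdx L ℓ, Φ (β i • OnePoint.infty) (β i • mapGL ℚ (γ : SL(2, ℤ)) • OnePoint.infty)) =
      heckeU 0 L K hℓ (fun (γ : Gamma0 L) (_ : Fin 1) => Φ OnePoint.infty (mapGL ℚ (γ : SL(2, ℤ)) • OnePoint.infty)) := by
  funext γ k
  rw [delta_hecke_cuspSymbol hℓ β hβ Φ hsym hinv γ, heckeU_apply, Finset.sum_apply]
  refine Finset.sum_congr rfl fun i _ => ?_
  rw [act_zero_eq_id, LinearMap.id_apply]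

end HeckeCochain

/-! ### §2  The level shift `Φ ↦ Φ∘A`, `A = diag(d, 1)`, and the discrepancy -/

section Shift

variable {L L' d : ℕ} [NeZero d] (h : L * d ∣ L') {K : Type*}
  (A : GL (Fin 2) ℚ) (hA : (A : Matrix (Fin 2) (Fin 2) ℚ) = !![(d : ℚ), 0; 0, 1])

include hA

omit [NeZero d] in
/-- `A = diag(d,1)` fixes `∞`. [folklore] -/
theorem diag_smul_infty : A • (OnePoint.infty : OnePoint ℚ) = OnePoint.infty := by
  rw [OnePoint.smul_infty_eq_self_iff]
  have := congrArg (fun M : Matrix (Fin 2) (Fin 2) ℚ => M 1 0) hA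
  simpa using this

/-- **The shift intertwining relation in `GL₂(ℚ)`**: `A · γ = δ_d(γ) · A` for `γ ∈ Γ₀(L')`, `L d ∣ L'`, where
`δ_d(γ) = diag(d,1) γ diag(d,1)⁻¹ ∈ Γ₀(L)` is the tree's `Gamma0.degeneracyConj L L' d h γ`
(`Gamma0.gmat_degeneracyConj_mul_diag`, cast). [folklore] -/
theorem diag_intertwine (γ : Gamma0 L') :
    A * mapGL ℚ (γ : SL(2, ℤ)) = mapGL ℚ ((Gamma0.degeneracyConj L L' d h γ : Gamma0 L) : SL(2, ℤ)) * A := by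
  apply Units.ext
  have hA' : (A : Matrix (Fin 2) (Fin 2) ℚ) = (!![(d : ℤ), 0; 0, 1] : Matrix (Fin 2) (Fin 2) ℤ).map (Int.castRingHom ℚ) := by
    rw [hA]
    ext i j; fin_cases i <;> fin_cases j <;> rfl
  rw [coe_mul_eq_cast_mul hA' (coe_mapGL_eq_map _), coe_mul_eq_cast_mul (coe_mapGL_eq_map _) hA']
  congr 1
  exact (Gamma0.gmat_degeneracyConj_mul_diag h γ).symm

variable (Φ : OnePoint ℚ → OnePoint ℚ → K)

include h

/-- **`Φ∘A` is `Γ₀(L')`-invariant** when `Φ` is `Γ₀(L)`-invariant (`L d ∣ L'`). [folklore] -/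
theorem shift_cuspSymbol_invariant
    (hinv : ∀ γ : Gamma0 L, ∀ a b, Φ (mapGL ℚ (γ : SL(2, ℤ)) • a) (mapGL ℚ (γ : SL(2, ℤ)) • b) = Φ a b)
    (γ : Gamma0 L') (a b : OnePoint ℚ) :
    Φ (A • mapGL ℚ (γ : SL(2, ℤ)) • a) (A • mapGL ℚ (γ : SL(2, ℤ)) • b) = Φ (A • a) (A • b) := by
  rw [← mul_smul, ← mul_smul, diag_intertwine h A hA γ, mul_smul, mul_smul, hinv]

/-- **`δ_{L'}(Φ∘A) = π_d^*(δ_L Φ)`**: `Φ(A∞, Aγ∞) = Φ(∞, δ_d(γ)∞)` for `γ ∈ Γ₀(L')` — the symbol side of the tree's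
`degeneracyPullback 0 L L' d` (MEMO-es §22.2 (2): «`δ_{tⁿL}(Φ|Aⁿ) = π_{tⁿ}^* u` because `AⁿγA⁻ⁿ = Gamma0.degeneracyConj`,
`Aⁿ∞ = ∞`»). [folklore] -/
theorem delta_shift_cuspSymbol (γ : Gamma0 L') :
    Φ (A • OnePoint.infty) (A • mapGL ℚ (γ : SL(2, ℤ)) • OnePoint.infty) =
      Φ OnePoint.infty (mapGL ℚ ((Gamma0.degeneracyConj L L' d h γ : Gamma0 L) : SL(2, ℤ)) • OnePoint.infty) := by
  rw [← mul_smul, diag_intertwine h A hA γ, mul_smul, diag_smul_infty A hA]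

omit [NeZero d] h hA in
/-- **`δ_{L'}Φ = π_1^*(δ_L Φ)`** (restriction along `Γ₀(L') ≤ Γ₀(L)`: same matrix). [folklore] -/
theorem delta_restrict_cuspSymbol (h1 : L * 1 ∣ L') (γ : Gamma0 L') :
    Φ OnePoint.infty (mapGL ℚ (γ : SL(2, ℤ)) • OnePoint.infty) =
      Φ OnePoint.infty (mapGL ℚ ((Gamma0.degeneracyConj L L' 1 h1 γ : Gamma0 L) : SL(2, ℤ)) • OnePoint.infty) := by
  rw [Gamma0.coe_degeneracyConj_one]

end Shift

section Discrepancy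

variable {L L' d : ℕ} [NeZero d] (h : L * d ∣ L') (h1 : L * 1 ∣ L') {K : Type*} [CommRing K]
  (A : GL (Fin 2) ℚ) (hA : (A : Matrix (Fin 2) (Fin 2) ℚ) = !![(d : ℚ), 0; 0, 1])
  (Φ : OnePoint ℚ → OnePoint ℚ → K)

include hA

/-- **Cochain form of the shift dictionary**: the boundary cochain of `Φ∘A` on `Γ₀(L')` is
`degeneracyPullback 0 L L' d K h` of the boundary cochain of `Φ` on `Γ₀(L)`. [folklore] -/
theorem delta_shift_cuspSymbol_eq_degeneracyPullback :
    (fun (γ : Gamma0 L') (_ : Fin 1) => Φ (A • OnePoint.infty) (A • mapGL ℚ (γ : SL(2, ℤ)) • OnePoint.infty)) =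
      degeneracyPullback 0 L L' d K h
        (fun (γ : Gamma0 L) (_ : Fin 1) => Φ OnePoint.infty (mapGL ℚ (γ : SL(2, ℤ)) • OnePoint.infty)) := by
  funext γ k
  rw [degeneracyPullback_zero_apply, delta_shift_cuspSymbol h A hA Φ γ]

omit hA in
/-- The boundary cochain of `Φ` on `Γ₀(L')` is `degeneracyPullback 0 L L' 1 K h1` (restriction) of its boundary cochain on
`Γ₀(L)`. [folklore] -/
theorem delta_restrict_cuspSymbol_eq_degeneracyPullback :
    (fun (γ : Gamma0 L') (_ : Fin 1) => Φ OnePoint.infty (mapGL ℚ (γ : SL(2, ℤ)) • OnePoint.infty)) =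
      degeneracyPullback 0 L L' 1 K h1
        (fun (γ : Gamma0 L) (_ : Fin 1) => Φ OnePoint.infty (mapGL ℚ (γ : SL(2, ℤ)) • OnePoint.infty)) := by
  funext γ k
  rw [degeneracyPullback_zero_apply, delta_restrict_cuspSymbol Φ h1 γ]

/-- **The discrepancy is a boundary symbol (MEMO-es §22.2 (2) / §23.2).**  Let `Φ` be a `Γ₀(L)`-invariant additive symbol
whose boundary cochain `u = (γ ↦ Φ(∞, γ∞))` is SHIFT-INVARIANT: `π_d^* u = π_1^* u` on `Γ₀(L')` (`L d ∣ L'`; the hypothesis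
of the leaf `RelativeIharaShiftVanishingBar` with `d = tⁿ`, `L' = L tⁿ`).  Then `D := Φ∘A − Φ`, `A = diag(d,1)`, is a
`Γ₀(L')`-invariant additive symbol with vanishing boundary map, hence a BOUNDARY symbol of level `L'`:
`D(a,b) = w(b) − w(a)` with `w` constant on `Γ₀(L')`-orbits (p2's `exists_boundary_of_delta_eq_zero`). [folklore] -/
theorem exists_boundary_of_shiftInvariant (hsym : ∀ a b c, Φ a b + Φ b c = Φ a c)
    (hinv : ∀ γ : Gamma0 L, ∀ a b, Φ (mapGL ℚ (γ : SL(2, ℤ)) • a) (mapGL ℚ (γ : SL(2, ℤ)) • b) = Φ a b)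
    (hshift : degeneracyPullback 0 L L' d K h
        (fun (γ : Gamma0 L) (_ : Fin 1) => Φ OnePoint.infty (mapGL ℚ (γ : SL(2, ℤ)) • OnePoint.infty)) =
      degeneracyPullback 0 L L' 1 K h1
        (fun (γ : Gamma0 L) (_ : Fin 1) => Φ OnePoint.infty (mapGL ℚ (γ : SL(2, ℤ)) • OnePoint.infty))) :
    (∀ a b c, (Φ (A • a) (A • b) - Φ a b) + (Φ (A • b) (A • c) - Φ b c) = Φ (A • a) (A • c) - Φ a c) ∧
    (∀ γ : Gamma0 L', ∀ a b,
      Φ (A • mapGL ℚ (γ : SL(2, ℤ)) • a) (A • mapGL ℚ (γ : SL(2, ℤ)) • b) -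
          Φ (mapGL ℚ (γ : SL(2, ℤ)) • a) (mapGL ℚ (γ : SL(2, ℤ)) • b) = Φ (A • a) (A • b) - Φ a b) ∧
    (∀ γ : Gamma0 L',
      Φ (A • OnePoint.infty) (A • mapGL ℚ (γ : SL(2, ℤ)) • OnePoint.infty) -
        Φ OnePoint.infty (mapGL ℚ (γ : SL(2, ℤ)) • OnePoint.infty) = 0) ∧
    ∃ w : OnePoint ℚ → K, (∀ γ : Gamma0 L', ∀ a, w (mapGL ℚ (γ : SL(2, ℤ)) • a) = w a) ∧
      ∀ a b, Φ (A • a) (A • b) - Φ a b = w b - w a := by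
  have hsymD : ∀ a b c, (Φ (A • a) (A • b) - Φ a b) + (Φ (A • b) (A • c) - Φ b c) = Φ (A • a) (A • c) - Φ a c := by
    intro a b c
    rw [← hsym (A • a) (A • b) (A • c), ← hsym a b c]; abel
  have hinvD : ∀ γ : Gamma0 L', ∀ a b,
      Φ (A • mapGL ℚ (γ : SL(2, ℤ)) • a) (A • mapGL ℚ (γ : SL(2, ℤ)) • b) -
          Φ (mapGL ℚ (γ : SL(2, ℤ)) • a) (mapGL ℚ (γ : SL(2, ℤ)) • b) = Φ (A • a) (A • b) - Φ a b := by
    intro γ a b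
    rw [shift_cuspSymbol_invariant h A hA Φ hinv γ a b,
      ← Gamma0.coe_degeneracyConj_one h1 γ, hinv]
  have hδD : ∀ γ : Gamma0 L',
      Φ (A • OnePoint.infty) (A • mapGL ℚ (γ : SL(2, ℤ)) • OnePoint.infty) -
        Φ OnePoint.infty (mapGL ℚ (γ : SL(2, ℤ)) • OnePoint.infty) = 0 := by
    intro γ
    have e := congrFun (congrFun hshift γ) 0
    simp only [degeneracyPullback_zero_apply] at e
    rw [delta_shift_cuspSymbol h A hA Φ γ, delta_restrict_cuspSymbol Φ h1 γ, e, sub_self]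
  refine ⟨hsymD, hinvD, hδD, ?_⟩
  exact exists_boundary_of_delta_eq_zero L' (fun a b => Φ (A • a) (A • b) - Φ a b) hsymD hinvD hδD

end Discrepancy

end Summit.BirchSwinnertonDyer.BirchSwinnertonDyer.Theorems.ManinLocalTwoThree
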